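import Summits.Ventures.HSemireg.WedgeHankelRecurrenceGaussFavardHankel

/-!
# Venture HSemireg — **`q_n/q_{n+1}` IS A STIELTJES–PICK FUNCTION**: for a positive three-term recurrence, at the zeros `y_0 < ⋯ < y_n` of `q_{n+1}` the coefficients
# `c_k = q_n(y_k)/q_{n+1}′(y_k)` are POSITIVE (Christoffel–Darboux: `q_{n+1}′(y_k) q_n(y_k) > 0`), `q_n = Σ_k c_k ∏_{j≠k} (X − y_j)` (partial fractions), `Σ_k c_k = 1`, and
# `q_n(x)/q_{n+1}(x) = Σ_k c_k/(x − y_k)` off the zeros — the resolvent entry `⟨e_n, (x − J_{n+1})^{-1} e_n⟩` of the Jacobi matrix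

HONEST FRAMING. Part of the Lean index of the computation cell `pub-hsemireg` (seat p10 gen 42, Sunday typer «UNIFORM-IN-n»).  Real polynomials and finite sums only; no variety, no
cohomology theory, no sheaf, no Ext group and no semiregularity map is constructed here; nothing here says that HC / HC_CM / HC_AV holds; no Literature fact (unproved `Prop`) is declared or
used.  Custodian versions as in `WedgeHankelSiegelIdeal` (1/3).
SOURCES (cited).  G. Szegő, *Orthogonal Polynomials*, Thm 3.3.5 («`p_{n}(x)/p_{n+1}(x) = Σ l_ν/(x − x_ν)`, `l_ν > 0`») and (3.2.4); N. I. Akhiezer, *The Classical Moment Problem* (1965), Ch. I §4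
(the rational function `P_n/P_{n+1}` has positive residues; nested-disc construction); T. S. Chihara, *An Introduction to Orthogonal Polynomials* (1978), Ch. I Thm 5.3 and Ch. III §4;
B. Simon, *The classical moment problem as a self-adjoint finite difference operator*, Adv. Math. 137 (1998) §4 (resolvent of the truncated Jacobi matrix).
PROOF TYPED HERE.  N274's confluent Christoffel–Darboux at a zero gives `q_{n+1}′(y_k) q_n(y_k) > 0`, so `c_k > 0`; `q_n` and `Σ_k c_k ∏_{j≠k}(X − y_j)` have degree `≤ n` and agree at the
`n + 1` zeros (`q_{n+1}′(y_k) = ∏_{j≠k}(y_k − y_j)`, N284); comparing `X^n`-coefficients gives `Σ c_k = 1`.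
DEDUP DISCLOSURE (`rg -n 'Pick|resolvent|ratio_partial' Summits/Ventures/HSemireg/WedgeHankelRecurrenceGauss*`, 2026-09-02): N284 expands `r_{n+1}/q_{n+1}` (second kind over first kind);
this file expands `q_n/q_{n+1}` (consecutive first kind).  The 4 names below: 0 hits tree-wide.

WHAT IS IN THE TREE.  N274 `recurrence_christoffel_darboux_confluent_pos`; N279 `recurrence_zeros`, `recurrence_monic_natDegree`, `eq_prod_X_sub_C_of_monic_of_roots`; N284
`eval_derivative_prod_X_sub_C_at_node`; Mathlib `Polynomial.eq_of_degrees_lt_of_eval_index_eq`, `Polynomial.leadingCoeff`.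
THIS FILE (namespace `Summit.Ventures.HSemireg.Wedge.HankelOuter` continued; CHAINED on N287 (import), N274, N279, N284; 0 definitions):
* §1053 `recurrence_ratio_coeff_pos` (`q_n(y_k)/q_{n+1}′(y_k) > 0`), **`recurrence_eq_sum_ratio_coeff_mul_prod`** (`q_n = Σ_k c_k ∏_{j≠k}(X − y_j)`), `recurrence_sum_ratio_coeff_eq_one`
  (`Σ_k c_k = 1`), **`recurrence_ratio_eq_sum_div`** (`q_n(x)/q_{n+1}(x) = Σ_k c_k/(x − y_k)`).
CAVEATS.  Nothing Ext-side.  New names only.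
-/

open Module Polynomial
open scoped Matrix Polynomial

namespace Summit.Ventures.HSemireg.Wedge.HankelOuter

/-! ## §1053. `q_n/q_{n+1}` as a sum of positive simple fractions -/

/-- **Positive residues**: at a zero `y` of `q_{n+1}` (positive `b`), `q_n(y)/q_{n+1}′(y) > 0`. [Szegő Thm 3.3.5 via (3.2.4); this file, §1053] -/
theorem recurrence_ratio_coeff_pos {q : ℕ → ℝ[X]} {a b : ℕ → ℝ} (hq0 : q 0 = 1) (hq1 : q 1 = Polynomial.X - C (a 0))
    (hrec : ∀ n, q (n + 2) = (Polynomial.X - C (a (n + 1))) * q (n + 1) - C (b (n + 1)) * q n) (hb : ∀ j, 0 < b j) (n : ℕ) {y : ℝ} (hy : (q (n + 1)).eval y = 0) :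
    0 < (q n).eval y / (derivative (q (n + 1))).eval y := by
  have h := recurrence_christoffel_darboux_confluent_pos hq0 hq1 hrec hb n y
  rw [hy, mul_zero, sub_zero] at h
  -- `q′(y) q_n(y) > 0` ⇒ the quotient is positive
  rcases lt_trichotomy 0 ((derivative (q (n + 1))).eval y) with hd | hd | hd
  · exact div_pos ((pos_iff_pos_of_mul_pos h).1 hd) hd
  · rw [← hd, zero_mul] at h; exact absurd h (lt_irrefl 0)
  · have hn : (q n).eval y < 0 := by nlinarith
    exact div_pos_of_neg_of_neg hn hd

/-- **PARTIAL FRACTIONS OF `q_n/q_{n+1}`**: with the zeros `y_0 < ⋯ < y_n` of `q_{n+1}` and `c_k = q_n(y_k)/q_{n+1}′(y_k)`, `q_n = Σ_k c_k ∏_{j≠k} (X − y_j)`. [Szegő Thm 3.3.5; Akhiezer I §4;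
this file, §1053] -/
theorem recurrence_eq_sum_ratio_coeff_mul_prod {q : ℕ → ℝ[X]} {a b : ℕ → ℝ} (hq0 : q 0 = 1) (hq1 : q 1 = Polynomial.X - C (a 0))
    (hrec : ∀ n, q (n + 2) = (Polynomial.X - C (a (n + 1))) * q (n + 1) - C (b (n + 1)) * q n) (n : ℕ) {y : Fin (n + 1) → ℝ} (hy : StrictMono y)
    (hyr : ∀ k, (q (n + 1)).eval (y k) = 0) :
    q n = ∑ k, C ((q n).eval (y k) / (derivative (q (n + 1))).eval (y k)) * ∏ j ∈ Finset.univ.erase k, (Polynomial.X - C (y j)) := by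
  obtain ⟨hQm, hQd⟩ := recurrence_monic_natDegree hq0 hq1 hrec (n + 1)
  have hQ := eq_prod_X_sub_C_of_monic_of_roots hQm hQd hy.injective hyr
  obtain ⟨-, hPd⟩ := recurrence_monic_natDegree hq0 hq1 hrec n
  have hys : Set.InjOn y (Finset.univ : Finset (Fin (n + 1))) := hy.injective.injOn.mono (Set.subset_univ _)
  refine eq_of_degrees_lt_of_eval_index_eq Finset.univ hys ?_ ?_ fun i _ => ?_
  · rw [Finset.card_univ, Fintype.card_fin]
    exact lt_of_le_of_lt degree_le_natDegree (by rw [hPd]; exact_mod_cast Nat.lt_succ_self n)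
  · rw [Finset.card_univ, Fintype.card_fin]
    have hnat : (∑ k, C ((q n).eval (y k) / (derivative (q (n + 1))).eval (y k)) * ∏ j ∈ Finset.univ.erase k, (Polynomial.X - C (y j))).natDegree ≤ n := by
      refine natDegree_sum_le_of_forall_le _ _ fun k _ => (natDegree_C_mul_le _ _).trans ?_
      rw [natDegree_prod_of_monic _ _ fun j _ => monic_X_sub_C (y j)]
      simp only [natDegree_X_sub_C, Finset.sum_const, Finset.card_erase_of_mem (Finset.mem_univ k), Finset.card_univ, Fintype.card_fin, smul_eq_mul, mul_one]
      omega
    exact lt_of_le_of_lt degree_le_natDegree (by exact_mod_cast Nat.lt_succ_of_le hnat)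
  · rw [eval_finsetSum, Finset.sum_eq_single i (fun k _ hki => by
        rw [eval_mul, eval_C, eval_prod, Finset.prod_eq_zero (Finset.mem_erase.2 ⟨Ne.symm hki, Finset.mem_univ i⟩) (by rw [eval_sub, eval_X, eval_C, sub_self]), mul_zero])
      (fun h => absurd (Finset.mem_univ i) h), eval_mul, eval_C, eval_prod]
    have hprod : ∏ j ∈ Finset.univ.erase i, (Polynomial.X - C (y j)).eval (y i) = (derivative (q (n + 1))).eval (y i) := by
      rw [hQ, eval_derivative_prod_X_sub_C_at_node]
      exact Finset.prod_congr rfl fun j _ => by rw [eval_sub, eval_X, eval_C]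
    have hne : (derivative (q (n + 1))).eval (y i) ≠ 0 := by
      rw [hQ, eval_derivative_prod_X_sub_C_at_node]
      exact Finset.prod_ne_zero_iff.2 fun j hj => sub_ne_zero.2 fun e => (Finset.mem_erase.1 hj).1 (hy.injective e).symm
    rw [hprod]
    field_simp

/-- **The residues sum to `1`** (both sides are monic-normalised: compare the coefficients of `X^n`). [Szegő Thm 3.3.5; this file, §1053] -/
theorem recurrence_sum_ratio_coeff_eq_one {q : ℕ → ℝ[X]} {a b : ℕ → ℝ} (hq0 : q 0 = 1) (hq1 : q 1 = Polynomial.X - C (a 0))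
    (hrec : ∀ n, q (n + 2) = (Polynomial.X - C (a (n + 1))) * q (n + 1) - C (b (n + 1)) * q n) (n : ℕ) {y : Fin (n + 1) → ℝ} (hy : StrictMono y)
    (hyr : ∀ k, (q (n + 1)).eval (y k) = 0) : ∑ k, (q n).eval (y k) / (derivative (q (n + 1))).eval (y k) = 1 := by
  obtain ⟨hPm, hPd⟩ := recurrence_monic_natDegree hq0 hq1 hrec n
  have h := congrArg (fun P => P.coeff n) (recurrence_eq_sum_ratio_coeff_mul_prod hq0 hq1 hrec n hy hyr)
  have hlead : (q n).coeff n = 1 := by have := hPm.coeff_natDegree; rwa [hPd] at this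
  rw [hlead, finsetSum_coeff] at h
  rw [h]
  refine Finset.sum_congr rfl fun k _ => ?_
  have hm : (∏ j ∈ Finset.univ.erase k, (Polynomial.X - C (y j))).Monic := monic_prod_of_monic _ _ fun j _ => monic_X_sub_C (y j)
  have hd : (∏ j ∈ Finset.univ.erase k, (Polynomial.X - C (y j))).natDegree = n := by
    rw [natDegree_prod_of_monic _ _ fun j _ => monic_X_sub_C (y j)]
    simp only [natDegree_X_sub_C, Finset.sum_const, Finset.card_erase_of_mem (Finset.mem_univ k), Finset.card_univ, Fintype.card_fin, smul_eq_mul, mul_one]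
    omega
  have hc : (∏ j ∈ Finset.univ.erase k, (Polynomial.X - C (y j))).coeff n = 1 := by have := hm.coeff_natDegree; rwa [hd] at this
  rw [coeff_C_mul, hc, mul_one]

/-- **`q_n(x)/q_{n+1}(x) = Σ_k c_k/(x − y_k)`** for `q_{n+1}(x) ≠ 0`, with positive `c_k` summing to `1`. [Szegő Thm 3.3.5; Akhiezer I §4; Simon 1998 §4; this file, §1053] -/
theorem recurrence_ratio_eq_sum_div {q : ℕ → ℝ[X]} {a b : ℕ → ℝ} (hq0 : q 0 = 1) (hq1 : q 1 = Polynomial.X - C (a 0))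
    (hrec : ∀ n, q (n + 2) = (Polynomial.X - C (a (n + 1))) * q (n + 1) - C (b (n + 1)) * q n) (n : ℕ) {y : Fin (n + 1) → ℝ} (hy : StrictMono y)
    (hyr : ∀ k, (q (n + 1)).eval (y k) = 0) {x : ℝ} (hx : (q (n + 1)).eval x ≠ 0) :
    (q n).eval x / (q (n + 1)).eval x = ∑ k, (q n).eval (y k) / (derivative (q (n + 1))).eval (y k) / (x - y k) := by
  obtain ⟨hQm, hQd⟩ := recurrence_monic_natDegree hq0 hq1 hrec (n + 1)
  have hQ := eq_prod_X_sub_C_of_monic_of_roots hQm hQd hy.injective hyr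
  conv_lhs => rw [recurrence_eq_sum_ratio_coeff_mul_prod hq0 hq1 hrec n hy hyr]
  rw [eval_finsetSum, Finset.sum_div]
  refine Finset.sum_congr rfl fun k _ => ?_
  have hsplit : (x - y k) * (∏ j ∈ Finset.univ.erase k, (Polynomial.X - C (y j))).eval x = (q (n + 1)).eval x := by
    have h := Finset.mul_prod_erase Finset.univ (fun j => (Polynomial.X - C (y j)).eval x) (Finset.mem_univ k)
    rw [eval_sub, eval_X, eval_C] at h
    rw [hQ, eval_prod, eval_prod]
    exact h
  have hne : (x - y k) * (∏ j ∈ Finset.univ.erase k, (Polynomial.X - C (y j))).eval x ≠ 0 := by rw [hsplit]; exact hx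
  obtain ⟨h1, h2⟩ := mul_ne_zero_iff.1 hne
  rw [eval_mul, eval_C, ← hsplit]
  field_simp

end Summit.Ventures.HSemireg.Wedge.HankelOuter
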